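import Mathlib.Analysis.Calculus.Deriv.MeanValue
import Mathlib.Analysis.SpecialFunctions.ExpDeriv
import Mathlib.MeasureTheory.Integral.IntervalIntegral.FundThmCalculus
import Mathlib.Topology.Order.Monotone
import Mathlib.Topology.MetricSpace.Pseudo.Defs
import Summits.NavierStokesRegularity.NavierStokesRegularity.Theorems.PerpetualPumpAveragedTypeIBlowupLinearComparison

/-!
# Crux `PerpetualPump.AveragedTypeIBlowup` (stmt-NavierStokesRegularity-1835), line `Sketch`:
# tools for the stub `incubation` — barriers, real induction, the damped deviation functional

Generic real-analysis lemmas (Mathlib + the landed `linearComparison_*`) used by the proof of the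
registered stub `stub_incubation` (phase I of the window one-step theorem: the seeded 2-mode front
pair until ignition) in `…IncubationApriori.lean`, `…IncubationBoot.lean`, `…Incubation.lean`.

* `incubation_le_of_deriv_nonneg` — `F a ≤ F b` when `F` is continuous on `[a, b]` with a
  nonnegative derivative inside.
* `incubation_le_of_Ico`, `incubation_lt_near` — the closed / open halves of a continuity
  (bootstrap) argument: a non-strict inequality between continuous functions passes to the right
  end of a half-open interval, a strict one persists a little to the right.
* `incubation_induction` — real induction on `[0, τ]` for a predicate that is closed from the left
  and locally extends to the right.
* `incubation_pos` — positivity barrier: `w(t₀) ≥ 0` and `w' ≥ K w - L |w| + c` with `c > 0` force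
  `w > 0` on `(t₀, t₁]` (two applications of `linearComparison_lower`).
* `incubation_deviation` — the damped deviation functional: `x(0) = 0` and
  `-x - p ≤ x' ≤ -x + q` with `p, q ≥ 0` give `-∫₀ᵗ p ≤ x(t) ≤ ∫₀ᵗ q`
  (monotonicity of `e^t (x ∓ ∫ …)`).
* `incubation_integral_mono`, `incubation_integral_le_const`, `incubation_integral_le_sub` —
  thin wrappers (continuous integrands on `[a, b]`) of interval-integral monotonicity and of the
  inequality form `∫ₐᵇ φ ≤ g b - g a` (`φ ≤ g'`) of the fundamental theorem of calculus.

## References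

Folklore ODE comparison arguments, used as in T. Tao, *Finite time blowup for an averaged
three-dimensional Navier–Stokes equation*, J. Amer. Math. Soc. 29 (2016), §5–6.
-/

noncomputable section

-- the summit namespace `…NavierStokesRegularity.NavierStokesRegularity…` is the tree convention
set_option linter.dupNamespace false

open MeasureTheory Set Filter Topology

namespace Summit.NavierStokesRegularity.NavierStokesRegularity.Theorems.PerpetualPumpAveragedTypeIBlowup

/-- **Monotonicity from the sign of the derivative.** If `F` is continuous on `[a, b]` and has a
nonnegative derivative at every interior point, then `F a ≤ F b`. [folklore] -/
theorem incubation_le_of_deriv_nonneg {F : ℝ → ℝ} {a b : ℝ} (hab : a ≤ b)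
    (hF : ContinuousOn F (Icc a b))
    (hd : ∀ t ∈ Ioo a b, ∃ F' : ℝ, HasDerivAt F F' t ∧ 0 ≤ F') : F a ≤ F b := by
  have hmono := monotoneOn_of_hasDerivWithinAt_nonneg (convex_Icc a b) hF (f' := deriv F) ?_ ?_
  · exact hmono (left_mem_Icc.2 hab) (right_mem_Icc.2 hab) hab
  · intro t ht
    rw [interior_Icc] at ht
    obtain ⟨F', hF', -⟩ := hd t ht
    exact hF'.differentiableAt.hasDerivAt.hasDerivWithinAt
  · intro t ht
    rw [interior_Icc] at ht
    obtain ⟨F', hF', h⟩ := hd t ht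
    rwa [hF'.deriv]

/-- **Closed half of the continuity argument.** If `F, G` are continuous on `[a, c]`,
`T ∈ (a, c]` and `F ≤ G` on `[a, T)`, then `F T ≤ G T`. [folklore] -/
theorem incubation_le_of_Ico {F G : ℝ → ℝ} {a c T : ℝ} (hF : ContinuousOn F (Icc a c))
    (hG : ContinuousOn G (Icc a c)) (hT : T ∈ Ioc a c) (h : ∀ u ∈ Ico a T, F u ≤ G u) :
    F T ≤ G T := by
  have hTc : T ∈ closure (Ico a T) := by
    rw [closure_Ico hT.1.ne]
    exact right_mem_Icc.2 hT.1.le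
  have hsub : Ico a T ⊆ Icc a c := fun u hu => ⟨hu.1, hu.2.le.trans hT.2⟩
  have hTI : T ∈ Icc a c := ⟨hT.1.le, hT.2⟩
  exact ContinuousWithinAt.closure_le hTc ((hF T hTI).mono hsub) ((hG T hTI).mono hsub) h

/-- **Open half of the continuity argument.** If `F, G` are continuous on `[a, c]`,
`T ∈ [a, c)` and `F T < G T`, then `F < G` on `[T, T + δ]` for some `δ > 0` with `T + δ ≤ c`.
[folklore] -/
theorem incubation_lt_near {F G : ℝ → ℝ} {a c T : ℝ} (hF : ContinuousOn F (Icc a c))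
    (hG : ContinuousOn G (Icc a c)) (hT : T ∈ Ico a c) (h : F T < G T) :
    ∃ δ : ℝ, 0 < δ ∧ T + δ ≤ c ∧ ∀ u ∈ Icc T (T + δ), F u < G u := by
  have hTI : T ∈ Icc a c := ⟨hT.1, hT.2.le⟩
  have hH : ContinuousWithinAt (fun u => G u - F u) (Icc a c) T := (hG T hTI).sub (hF T hTI)
  have h0 : (0 : ℝ) < G T - F T := sub_pos.2 h
  have hev : ∀ᶠ u in 𝓝[Icc a c] T, 0 < G u - F u := hH.eventually (lt_mem_nhds h0)
  obtain ⟨ε, hε, hball⟩ := Metric.mem_nhdsWithin_iff.1 hev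
  refine ⟨min (ε / 2) (c - T), lt_min (half_pos hε) (sub_pos.2 hT.2), ?_, fun u hu => ?_⟩
  · linarith [min_le_right (ε / 2) (c - T)]
  · have hu1 : u - T ≤ ε / 2 := by linarith [hu.2, min_le_left (ε / 2) (c - T)]
    have hu2 : u ≤ c := by linarith [hu.2, min_le_right (ε / 2) (c - T)]
    have hmem : u ∈ Metric.ball T ε ∩ Icc a c := by
      refine ⟨?_, hT.1.trans hu.1, hu2⟩
      rw [Metric.mem_ball, Real.dist_eq, abs_of_nonneg (sub_nonneg.2 hu.1)]
      linarith
    exact sub_pos.1 (hball hmem)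

/-- **Real induction on `[0, τ]`.** A predicate holding at `0`, passing to right ends of half-open
intervals on which it holds, and extending a little to the right of any initial segment on which
it holds, holds on all of `[0, τ]` (consider the supremum of the good initial segments).
[folklore] -/
theorem incubation_induction {P : ℝ → Prop} {τ : ℝ} (hτ : 0 ≤ τ) (h0 : P 0)
    (hclosed : ∀ T ∈ Ioc 0 τ, (∀ u ∈ Ico 0 T, P u) → P T)
    (hopen : ∀ T ∈ Ico 0 τ, (∀ u ∈ Icc 0 T, P u) →
      ∃ δ : ℝ, 0 < δ ∧ ∀ u ∈ Ioc T (T + δ), u ≤ τ → P u) :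
    ∀ u ∈ Icc 0 τ, P u := by
  set E : Set ℝ := {σ | 0 ≤ σ ∧ σ ≤ τ ∧ ∀ u ∈ Icc 0 σ, P u} with hE
  have hE0 : (0 : ℝ) ∈ E := by
    refine ⟨le_rfl, hτ, fun u hu => ?_⟩
    rw [le_antisymm hu.2 hu.1]
    exact h0
  have hne : E.Nonempty := ⟨0, hE0⟩
  have hbdd : BddAbove E := ⟨τ, fun σ hσ => hσ.2.1⟩
  have hT0 : 0 ≤ sSup E := le_csSup hbdd hE0
  have hTτ : sSup E ≤ τ := csSup_le hne fun σ hσ => hσ.2.1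
  -- the predicate holds strictly below the supremum
  have hlt : ∀ u ∈ Ico 0 (sSup E), P u := by
    intro u hu
    obtain ⟨σ, hσE, huσ⟩ := exists_lt_of_lt_csSup hne hu.2
    exact hσE.2.2 u ⟨hu.1, huσ.le⟩
  -- hence at the supremum
  have hat : ∀ u ∈ Icc 0 (sSup E), P u := by
    intro u hu
    rcases hu.2.lt_or_eq with hlt' | heq
    · exact hlt u ⟨hu.1, hlt'⟩
    · rw [heq]
      rcases hT0.lt_or_eq with hpos | hzero
      · exact hclosed (sSup E) ⟨hpos, hTτ⟩ hlt
      · rw [← hzero]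
        exact h0
  -- the supremum is `τ`
  have hTeq : sSup E = τ := by
    by_contra hne'
    have hTlt : sSup E < τ := lt_of_le_of_ne hTτ hne'
    obtain ⟨δ, hδ, hext⟩ := hopen (sSup E) ⟨hT0, hTlt⟩ hat
    set T' := min (sSup E + δ) τ with hT'
    have hT'gt : sSup E < T' := lt_min (by linarith) hTlt
    have hT'E : T' ∈ E := by
      refine ⟨hT0.trans hT'gt.le, min_le_right _ _, fun u hu => ?_⟩
      rcases le_or_gt u (sSup E) with hle | hgt
      · exact hat u ⟨hu.1, hle⟩
      · exact hext u ⟨hgt, hu.2.trans (min_le_left _ _)⟩ (hu.2.trans (min_le_right _ _))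
    exact (not_le.2 hT'gt) (le_csSup hbdd hT'E)
  intro u hu
  exact hat u (by rwa [hTeq])

/-- **Positivity barrier.** Let `w, K, c` be continuous on `[t₀, t₁]`, `c > 0` there, `w t₀ ≥ 0`,
and at interior points `w' ≥ K w - L |w| + c`. Then `w > 0` on `(t₀, t₁]`. (If `w` were negative
at `u`, then on the last interval `[s, u]` where `w ≤ 0` the inequality reads `w' ≥ (K + L) w + c`
and `linearComparison_lower` started from `w s ≥ 0` gives `w u ≥ 0`; so `w ≥ 0`, whence
`w' ≥ (K - L) w + c` and the same comparison gives `w > 0` after `t₀`.) [folklore] -/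
theorem incubation_pos {w K c : ℝ → ℝ} {L t₀ t₁ : ℝ} (h01 : t₀ ≤ t₁)
    (hK : ContinuousOn K (Icc t₀ t₁)) (hc : ContinuousOn c (Icc t₀ t₁))
    (hw : ContinuousOn w (Icc t₀ t₁)) (hcpos : ∀ t ∈ Icc t₀ t₁, 0 < c t) (hw0 : 0 ≤ w t₀)
    (hd : ∀ t ∈ Ioo t₀ t₁, ∃ w' : ℝ, HasDerivAt w w' t ∧ K t * w t - L * |w t| + c t ≤ w') :
    ∀ t ∈ Ioc t₀ t₁, 0 < w t := by
  -- Step 1: `w ≥ 0` on `[t₀, t₁]`.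
  have hnn : ∀ u ∈ Icc t₀ t₁, 0 ≤ w u := by
    intro u hu
    by_contra hneg
    rw [not_le] at hneg
    set Q : Set ℝ := Icc t₀ u ∩ w ⁻¹' (Ici 0) with hQ
    have hwu : ContinuousOn w (Icc t₀ u) := hw.mono (Icc_subset_Icc_right hu.2)
    have hQc : IsClosed Q := hwu.preimage_isClosed_of_isClosed isClosed_Icc isClosed_Ici
    have hQ0 : t₀ ∈ Q := ⟨left_mem_Icc.2 hu.1, hw0⟩
    have hQne : Q.Nonempty := ⟨t₀, hQ0⟩
    have hQbdd : BddAbove Q := ⟨u, fun x hx => hx.1.2⟩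
    have hsQ : sSup Q ∈ Q := hQc.csSup_mem hQne hQbdd
    have hsu : sSup Q ≤ u := hsQ.1.2
    have hws : 0 ≤ w (sSup Q) := hsQ.2
    have hslt : sSup Q < u := by
      rcases hsu.lt_or_eq with h | h
      · exact h
      · exact absurd (h ▸ hws) (not_le.2 hneg)
    have hbetween : ∀ x ∈ Ioc (sSup Q) u, w x < 0 := by
      intro x hx
      by_contra hx0
      rw [not_lt] at hx0
      have hxQ : x ∈ Q := ⟨⟨hsQ.1.1.trans hx.1.le, hx.2⟩, hx0⟩
      exact (not_le.2 hx.1) (le_csSup hQbdd hxQ)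
    -- comparison on `[sSup Q, u]` with rate `K + L`
    have hsub : Icc (sSup Q) u ⊆ Icc t₀ t₁ := Icc_subset_Icc hsQ.1.1 hu.2
    have hK' : ContinuousOn (fun x => K x + L) (Icc (sSup Q) u) :=
      (hK.mono hsub).add continuousOn_const
    have hd' : ∀ x ∈ Ioo (sSup Q) u, ∃ w' : ℝ, HasDerivAt w w' x ∧
        (K x + L) * w x + c x ≤ w' := by
      intro x hx
      obtain ⟨w', hw', hle⟩ := hd x ⟨hsQ.1.1.trans_lt hx.1, hx.2.trans_le hu.2⟩
      refine ⟨w', hw', ?_⟩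
      have hwx : w x < 0 := hbetween x ⟨hx.1, hx.2.le⟩
      rw [abs_of_neg hwx] at hle
      linarith
    have hcmp := linearComparison_lower hslt.le hK' (hc.mono hsub) (hw.mono hsub) hd'
      (right_mem_Icc.2 hslt.le)
    have hI : 0 ≤ ∫ s in sSup Q..u,
        Real.exp (-(∫ r in sSup Q..s, (K r + L))) * c s :=
      intervalIntegral.integral_nonneg hslt.le fun s hs =>
        mul_nonneg (Real.exp_pos _).le (hcpos s (hsub hs)).le
    have hE := Real.exp_pos (∫ s in sSup Q..u, (K s + L))
    have : 0 ≤ w u := le_trans (mul_nonneg hE.le (by linarith)) hcmp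
    linarith
  -- Step 2: comparison on `[t₀, t₁]` with rate `K - L`.
  intro t ht
  have hK' : ContinuousOn (fun x => K x - L) (Icc t₀ t₁) := hK.sub continuousOn_const
  have hd' : ∀ x ∈ Ioo t₀ t₁, ∃ w' : ℝ, HasDerivAt w w' x ∧ (K x - L) * w x + c x ≤ w' := by
    intro x hx
    obtain ⟨w', hw', hle⟩ := hd x hx
    refine ⟨w', hw', ?_⟩
    rw [abs_of_nonneg (hnn x (Ioo_subset_Icc_self hx))] at hle
    linarith
  have htI : t ∈ Icc t₀ t₁ := ⟨ht.1.le, ht.2⟩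
  have hcmp := linearComparison_lower h01 hK' hc hw hd' htI
  obtain ⟨hPc, -⟩ := linearComparison_primitive h01 hK'
  have hgc : ContinuousOn (fun s => Real.exp (-(∫ r in t₀..s, (K r - L))) * c s) (Icc t₀ t₁) :=
    hPc.neg.rexp.mul hc
  have hI : 0 < ∫ s in t₀..t, Real.exp (-(∫ r in t₀..s, (K r - L))) * c s :=
    intervalIntegral.intervalIntegral_pos_of_pos_on
      ((hgc.mono (Icc_subset_Icc_right ht.2)).intervalIntegrable_of_Icc ht.1.le)
      (fun s hs => mul_pos (Real.exp_pos _) (hcpos s ⟨hs.1.le, hs.2.le.trans ht.2⟩)) ht.1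
  have hE := Real.exp_pos (∫ s in t₀..t, (K s - L))
  exact lt_of_lt_of_le (mul_pos hE (by linarith)) hcmp

/-- **The damped deviation functional.** Let `x, p, q` be continuous on `[0, τ]` with `p, q ≥ 0`,
`x 0 = 0`, and at interior points `-x - p ≤ x' ≤ -x + q`. Then `-∫₀ᵗ p ≤ x t ≤ ∫₀ᵗ q` on
`[0, τ]`: the functions `e^t (x t - ∫₀ᵗ q)` and `-e^t (x t + ∫₀ᵗ p)` have nonpositive derivative.
(Used for `x = b - B e^{-σ}`, the deviation of the carrier from free viscous decay.) [folklore] -/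
theorem incubation_deviation {x p q : ℝ → ℝ} {τ : ℝ} (hx : ContinuousOn x (Icc 0 τ)) (hp : ContinuousOn p (Icc 0 τ))
    (hq : ContinuousOn q (Icc 0 τ)) (hp0 : ∀ t ∈ Icc 0 τ, 0 ≤ p t)
    (hq0 : ∀ t ∈ Icc 0 τ, 0 ≤ q t) (hx0 : x 0 = 0)
    (hd : ∀ t ∈ Ioo 0 τ, ∃ x' : ℝ, HasDerivAt x x' t ∧ -x t - p t ≤ x' ∧ x' ≤ -x t + q t) :
    ∀ t ∈ Icc 0 τ, -(∫ s in (0 : ℝ)..t, p s) ≤ x t ∧ x t ≤ ∫ s in (0 : ℝ)..t, q s := by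
  intro t ht
  have hxt : ContinuousOn x (Icc 0 t) := hx.mono (Icc_subset_Icc_right ht.2)
  have hpt : ContinuousOn p (Icc 0 t) := hp.mono (Icc_subset_Icc_right ht.2)
  have hqt : ContinuousOn q (Icc 0 t) := hq.mono (Icc_subset_Icc_right ht.2)
  obtain ⟨hPc, hPd⟩ := linearComparison_primitive ht.1 hpt
  obtain ⟨hQc, hQd⟩ := linearComparison_primitive ht.1 hqt
  have hexpc : ContinuousOn (fun s => Real.exp s) (Icc 0 t) := Real.continuous_exp.continuousOn
  constructor
  · -- lower bound: `s ↦ e^s (x s + ∫₀ˢ p)` is nondecreasing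
    have hF := incubation_le_of_deriv_nonneg ht.1
      (F := fun s => Real.exp s * (x s + ∫ r in (0 : ℝ)..s, p r)) (hexpc.mul (hxt.add hPc)) ?_
    · simp only [Real.exp_zero, intervalIntegral.integral_same, add_zero, one_mul, hx0] at hF
      have hE := Real.exp_pos t
      have h1 : 0 ≤ x t + ∫ r in (0 : ℝ)..t, p r := by
        by_contra hlt
        rw [not_le] at hlt
        linarith [mul_neg_of_pos_of_neg hE hlt]
      linarith
    · intro s hs
      obtain ⟨x', hx', hlo, -⟩ := hd s ⟨hs.1, hs.2.trans_le ht.2⟩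
      refine ⟨Real.exp s * (x s + ∫ r in (0 : ℝ)..s, p r) + Real.exp s * (x' + p s),
        (Real.hasDerivAt_exp s).mul (hx'.add (hPd s hs)), ?_⟩
      have hE := Real.exp_pos s
      have hI : 0 ≤ ∫ r in (0 : ℝ)..s, p r :=
        intervalIntegral.integral_nonneg hs.1.le fun r hr =>
          hp0 r ⟨hr.1, hr.2.trans (hs.2.le.trans ht.2)⟩
      have h2 : 0 ≤ (x s + ∫ r in (0 : ℝ)..s, p r) + (x' + p s) := by linarith
      nlinarith
  · -- upper bound: `s ↦ -(e^s (x s - ∫₀ˢ q))` is nondecreasing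
    have hF := incubation_le_of_deriv_nonneg ht.1
      (F := fun s => -(Real.exp s * (x s - ∫ r in (0 : ℝ)..s, q r)))
      (hexpc.mul (hxt.sub hQc)).neg ?_
    · simp only [Real.exp_zero, intervalIntegral.integral_same, sub_zero, one_mul, hx0,
        neg_zero] at hF
      have hE := Real.exp_pos t
      have h1 : x t - ∫ r in (0 : ℝ)..t, q r ≤ 0 := by
        by_contra hlt
        rw [not_le] at hlt
        linarith [mul_pos hE hlt]
      linarith
    · intro s hs
      obtain ⟨x', hx', -, hhi⟩ := hd s ⟨hs.1, hs.2.trans_le ht.2⟩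
      refine ⟨-(Real.exp s * (x s - ∫ r in (0 : ℝ)..s, q r) + Real.exp s * (x' - q s)),
        ((Real.hasDerivAt_exp s).mul (hx'.sub (hQd s hs))).neg, ?_⟩
      have hE := Real.exp_pos s
      have hI : 0 ≤ ∫ r in (0 : ℝ)..s, q r :=
        intervalIntegral.integral_nonneg hs.1.le fun r hr =>
          hq0 r ⟨hr.1, hr.2.trans (hs.2.le.trans ht.2)⟩
      have h2 : (x s - ∫ r in (0 : ℝ)..s, q r) + (x' - q s) ≤ 0 := by linarith
      nlinarith

/-- **Comparison of integrals of continuous functions.** If `f ≤ g` on `[a, b]` and both are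
continuous there, then `∫ₐᵇ f ≤ ∫ₐᵇ g`. [folklore] -/
theorem incubation_integral_mono {f g : ℝ → ℝ} {a b : ℝ} (hab : a ≤ b)
    (hf : ContinuousOn f (Icc a b)) (hg : ContinuousOn g (Icc a b))
    (h : ∀ x ∈ Icc a b, f x ≤ g x) : ∫ x in a..b, f x ≤ ∫ x in a..b, g x :=
  intervalIntegral.integral_mono_on hab (hf.intervalIntegrable_of_Icc hab)
    (hg.intervalIntegrable_of_Icc hab) h

/-- **Integral of a continuous function bounded by a constant.** If `f ≤ C` on `[a, b]` and `f` is
continuous there, then `∫ₐᵇ f ≤ C (b - a)`. [folklore] -/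
theorem incubation_integral_le_const {f : ℝ → ℝ} {a b C : ℝ} (hab : a ≤ b)
    (hf : ContinuousOn f (Icc a b)) (h : ∀ x ∈ Icc a b, f x ≤ C) :
    ∫ x in a..b, f x ≤ C * (b - a) := by
  have h1 := incubation_integral_mono hab hf continuousOn_const h
  rw [intervalIntegral.integral_const, smul_eq_mul] at h1
  linarith

/-- **Integral form of a differential inequality.** If `g, φ` are continuous on `[a, b]` and at
every interior point `g` has a derivative `≥ φ`, then `∫ₐᵇ φ ≤ g b - g a` (the inequality version
of the fundamental theorem of calculus, `intervalIntegral.integral_le_sub_of_hasDeriv_right_of_le`).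
[folklore] -/
theorem incubation_integral_le_sub {g φ : ℝ → ℝ} {a b : ℝ} (hab : a ≤ b)
    (hg : ContinuousOn g (Icc a b)) (hφ : ContinuousOn φ (Icc a b))
    (hd : ∀ x ∈ Ioo a b, ∃ g' : ℝ, HasDerivAt g g' x ∧ φ x ≤ g') :
    ∫ x in a..b, φ x ≤ g b - g a := by
  refine intervalIntegral.integral_le_sub_of_hasDeriv_right_of_le hab hg (g' := deriv g)
    (fun x hx => ?_) (hφ.integrableOn_Icc) (fun x hx => ?_)
  · obtain ⟨g', hg', -⟩ := hd x hx
    exact hg'.differentiableAt.hasDerivAt.hasDerivWithinAt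
  · obtain ⟨g', hg', hle⟩ := hd x hx
    rwa [hg'.deriv]

/-- **Registered sub-goal `stub_incubationDeviation` of the stub `incubation`** (closed form of
`incubation_deviation`): `x 0 = 0` and `-x - p ≤ x' ≤ -x + q` inside `[0, τ]` with continuous
`p, q ≥ 0` give `-∫₀ᵗ p ≤ x t ≤ ∫₀ᵗ q` on `[0, τ]`. [folklore] -/
theorem stub_incubationDeviation :
    ∀ (x p q : ℝ → ℝ) (τ : ℝ), ContinuousOn x (Icc 0 τ) → ContinuousOn p (Icc 0 τ) →
      ContinuousOn q (Icc 0 τ) → (∀ t ∈ Icc 0 τ, 0 ≤ p t) → (∀ t ∈ Icc 0 τ, 0 ≤ q t) → x 0 = 0 →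
      (∀ t ∈ Ioo 0 τ, ∃ x' : ℝ, HasDerivAt x x' t ∧ -x t - p t ≤ x' ∧ x' ≤ -x t + q t) →
      ∀ t ∈ Icc 0 τ, -(∫ s in (0 : ℝ)..t, p s) ≤ x t ∧ x t ≤ ∫ s in (0 : ℝ)..t, q s :=
  fun _ _ _ _ hx hp hq hp0 hq0 hx0 hd => incubation_deviation hx hp hq hp0 hq0 hx0 hd

end Summit.NavierStokesRegularity.NavierStokesRegularity.Theorems.PerpetualPumpAveragedTypeIBlowup

end
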